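import Literature.NumberTheory.LFunctions.ConreyIwaniec2002SpacingMechanism
import Mathlib.NumberTheory.NumberField.DedekindZeta
import HarnessLib

/-!
# Conrey–Iwaniec (2002), §7: the objects of the approximate functional equation (Proposition 7.1)

Conrey–Iwaniec, *Spacing of zeros of Hecke L-functions and the class number problem*, Acta Arith.
103 (2002), §7 (7.9)–(7.14) [held text `paper:arxiv-math_0111012`, p0017], and Proposition 8.1
(8.10), §8 p. 19.

DEFINITIONS (with bodies) of the four objects of the exact "approximate functional equation"
(7.12) for the class group `L`-functions `L(s, ψ)` of `K = ℚ(√−q)`, in the form used by the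
kernel line `prop81-afe-plancherel` for Proposition 8.1 (cell landau-siegel / ls-inputs):

* `afeG u = e^{u²}` — the test function `G` of (7.9)–(7.11). DESIGN CHOICE: the paper's
  `G(u) = cos(πu/A)^{−A}` (7.15) has poles at `u = ±A/2`, which the proofs of (7.17)/(7.25) move
  contours through; any ENTIRE even `G` with `G(0) = 1` and rapid decay on vertical lines serves
  §§7–8 verbatim, and `e^{u²}` (`|G(c+iv)| = e^{c²−v²}`) is the standard such choice.
* `afeV s y = V_s(y) = (1/2πi)∫_{(1)} Γ(s+u)/Γ(s) · G(u) y^{−u} du/u` (7.14), written on `u = 1+iv`.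
* `afeA K ψ q s = A(s) = Σ_n λ_ψ(n) n^{−s} V_s(n/Q)`, the first sum of (7.12) (`Q = √q/2π`, the
  tree's `condQ`; `λ_ψ` the tree's `twistCount K (classGroupCharIdealHom ψ)`), as an `LSeries`.
* `afeR K ψ q s` — the residual term of (7.12) ("exists only if `ψ` is the trivial character"),
  CORRECTED. The paper prints the residual as the single term
  `− G(s−1)/((s−1)Γ(s)) · Q^{1−s} L(1,χ)` (p0017, (7.12)), i.e. (G even) `+ Q^{1−s}L(1,χ)G(1−s)/((1−s)Γ(s))`,
  which is the residue of `Λ(s+u)G(u)/u` at `u = 1 − s` only; moving `Re u = 1` to `Re u = −1` also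
  crosses the pole of `Λ(s+u)` at `u = −s` (`Λ` has poles at `0` and `1`, `Λ(w) = Λ(1−w)`), and with
  both residues the residual is `−κ_K Q^{1−s} Γ(s)^{−1} (G(1−s)/(1−s) + G(s)/s)` — symmetric under
  `s ↔ 1−s` as it must be (both `Λ(s)` and `I(s) + I(1−s)` are), which the printed single term is
  not. Here `κ_K = res_{s=1} ζ_K(s)` (Mathlib's `NumberField.dedekindZeta_residue`), which equals
  `L(1,χ)` for `K = ℚ(√−q)` since `ζ_K = ζ·L(·,χ)` (7.7); in the paper's normalisation
  `Λ(s) = Q^sΓ(s)L(s)` (7.6) the residue of `Λ_K` at `1` is `Qκ_K` and the divisor is `Q^sΓ(s)`.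
  The sign/second term are immaterial for §8 (the residual is `O(e^{−t²})` on the critical line).

NAMED STATEMENT (a `def … : Prop`, no proof claimed here): `conreyIwaniec2002_proposition81_large_close`
— Proposition 8.1 (8.10) for `1`-spaced `S ⊂ (T, 2T]` in the range of its printed proof:
`q^66 ≤ T`, `e^{(log q)²} ≤ T`, companions `s′ = ½ + it′(t)` with `|t′(t) − t| ≤ 1`. WHY THIS
FORM (numbers): (i) §8 estimates `A_{13}, A_{23}, A_{33}` through Proposition 5.4, whose main term
`∫K(t/T)|A(it)|²dt` has `K ≥ 1` on `[1/2, 3]` (p0014), so Proposition 6.4 (6.52) — an integral over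
`[T,2T]`, `T ≥ q^65` — is invoked at `T/2` (honest threshold `2q^65`); (ii) the divided-difference
identity (7.23) with Lemma 7.4 (7.25) is a CLOSE-companion argument (for `|s′| ≫ |s|`,
`v_s(y) ≈ 1/|s−s′|` on `|s| ≪ y ≪ |s′|`), and for the companion map `t′ ≡ t*` at distance `1` from
`S` the unrestricted (8.10) would be the pointwise bound `|L(½+it*)|² ≪ T(log q)^7 + Tℒ(T)(log T)^4`;
downstream ((10.10): `|t − t′| ≤ π(1−α)/log t`) only close companions occur. The tree's
`ConreyIwaniec2002PrincipalEstimateClose.lean` derives the whole §§9–10 chain (Proposition 9.2-weak,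
Corollary 10.2, Theorem 1.1-weak, the Dedekind door) from this statement BY NAME of its conclusions.

PROVED here besides the definitions: the small API for `G` (`afeG_zero`, `afeG_neg`, `afeG_conj`,
`norm_afeG`, `differentiable_afeG`), `afeR_of_ne_one`, and the implication
`conreyIwaniec2002_proposition81_large_close_of_proposition81` from the typed Proposition 8.1.

«The programme SEARCHES and TYPES; no claim about Landau–Siegel zeros, Theorems 1–2 of
arXiv:2211.02515 or a repaired Margin232 until a kernel theorem says so.»

## References
* [ConreyIwaniec2002] B. Conrey, H. Iwaniec, Acta Arith. 103 (2002) 259–312, arXiv:math/0111012: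
  §7 (7.9)–(7.14), Proposition 7.1 (7.12); §8 Proposition 8.1 (8.10); §5 Proposition 5.4 (5.18).
-/

noncomputable section

open scoped NumberField
open Complex

namespace Literature.NumberTheory.LFunctions

namespace ConreyIwaniec2002

open NumberField

/-! ### The test function `G` -/

/-- **`G(u) = e^{u²}`**, the test function of (7.9)–(7.11): holomorphic (entire), `G(u) = G(−u)`,
`G(0) = 1`, bounded (indeed Gaussian-decaying) on vertical lines in `|Re u| ≤ A`.
[cite: ConreyIwaniec2002, §7 (7.9)–(7.11)] -/
def afeG (u : ℂ) : ℂ := Complex.exp (u ^ 2)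

/-! ### `V_s(y)`, `A(s)`, the residual term -/

/-- **`V_s(y) = (1/2πi) ∫_{(1)} Γ(s+u)/Γ(s) · G(u) y^{−u} du/u`** (7.14), the line `Re u = 1`
parametrised by `u = 1 + iv` (`du/(2πi) = dv/(2π)`). [cite: ConreyIwaniec2002, Proposition 7.1 (7.14)] -/
def afeV (s : ℂ) (y : ℝ) : ℂ :=
  (1 / (2 * Real.pi) : ℂ) * ∫ v : ℝ, Complex.Gamma (s + (1 + v * I)) / Complex.Gamma s *
    afeG (1 + v * I) * (y : ℂ) ^ (-(1 + v * I)) / (1 + v * I)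

variable (K : Type) [Field K] [NumberField K]

/-- **`A(s) = Σ_n λ(n) n^{−s} V_s(n/Q)`**, the first sum of (7.12) (`λ = λ_ψ` (7.1) the tree's
`twistCount K (classGroupCharIdealHom ψ)`, `Q = √q/2π` the tree's `condQ`), as the `L`-series of
`n ↦ λ(n) V_s(n/Q)` at `s`. [cite: ConreyIwaniec2002, Proposition 7.1 (7.12)] -/
def afeA (ψ : ClassGroup (𝓞 K) →* ℂˣ) (q : ℕ) (s : ℂ) : ℂ :=
  LSeries (fun n ↦ twistCount K (classGroupCharIdealHom ψ) n * afeV s (n / condQ q)) s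

/-- **The residual term of (7.12), corrected** ("the last (the residual) term in (7.12) exists only
if `ψ` is the trivial character"). PRINTED: `− G(s−1)/((s−1)Γ(s)) · Q^{1−s} L(1,χ)`, the residue of
`Λ_K(s+u)G(u)/u` at `u = 1−s` alone. HERE: `−κ_K Q^{1−s} Γ(s)^{−1} (G(1−s)/(1−s) + G(s)/s)` for
`ψ = 1` (`0` for `ψ ≠ 1`), the contributions of BOTH simple poles crossed when `Re u = 1` is moved
to `Re u = −1`: at `u = 1 − s` (residue `Qκ_K G(1−s)/(1−s)` of `Λ_K(s+u)G(u)/u`, `Λ = Q^sΓ(s)L(s)`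
(7.6)) and at `u = −s` (residue `Qκ_K G(s)/s`, by `Λ_K(w) = Λ_K(1−w)`), divided by `Q^sΓ(s)`;
`κ_K = res_{s=1}ζ_K` (`NumberField.dedekindZeta_residue`; `= L(1,χ)` for `K = ℚ(√−q)` by (7.7)).
The printed single term misses the `u = −s` residue (and the corrected residual is `s ↔ 1−s`
symmetric, as `Λ(s) − I(s) − I(1−s)` must be); immaterial for §8, where the residual is
`O(e^{−t²})`. [cite: ConreyIwaniec2002, Proposition 7.1 (7.12)] -/
def afeR (ψ : ClassGroup (𝓞 K) →* ℂˣ) (q : ℕ) (s : ℂ) : ℂ :=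
  if ψ = 1 then
    -(NumberField.dedekindZeta_residue K : ℂ) * (condQ q : ℂ) ^ (1 - s) / Complex.Gamma s *
      (afeG (1 - s) / (1 - s) + afeG s / s)
  else 0

/-! ### Small API -/

/-- (7.10): `G(0) = 1`. [cite: ConreyIwaniec2002, §7 (7.10)] -/
@[simp] theorem afeG_zero : afeG 0 = 1 := by simp [afeG]

/-- (7.9): `G(−u) = G(u)`. [cite: ConreyIwaniec2002, §7 (7.9)] -/
@[simp] theorem afeG_neg (u : ℂ) : afeG (-u) = afeG u := by simp [afeG]

/-- `G(ū) = conj G(u)` (so that `V(s̄,y) = conj V(s,y)`). [cite: ConreyIwaniec2002, §7 (7.9)] -/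
theorem afeG_conj (u : ℂ) : afeG (starRingEnd ℂ u) = starRingEnd ℂ (afeG u) := by
  simp [afeG, ← Complex.exp_conj, map_pow]

/-- `|G(c + iv)| = e^{c² − v²}` — Gaussian decay on vertical lines ((7.11), quantitatively).
[cite: ConreyIwaniec2002, §7 (7.11)] -/
theorem norm_afeG (c v : ℝ) : ‖afeG (c + v * I)‖ = Real.exp (c ^ 2 - v ^ 2) := by
  rw [afeG, Complex.norm_exp]
  congr 1
  have : ((c : ℂ) + v * I) ^ 2 = ((c ^ 2 - v ^ 2 : ℝ) : ℂ) + ((2 * c * v : ℝ) : ℂ) * I := by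
    push_cast
    ring_nf
    rw [Complex.I_sq]
    ring
  rw [this, Complex.add_re, Complex.ofReal_re, Complex.re_ofReal_mul, Complex.I_re, mul_zero,
    add_zero]

/-- `G` is entire. [cite: ConreyIwaniec2002, §7 (7.9)] -/
theorem differentiable_afeG : Differentiable ℂ afeG := by
  unfold afeG; fun_prop

variable {K} in
/-- For a non-trivial character the residual term vanishes. [cite: ConreyIwaniec2002, Proposition 7.1 (7.12)] -/
@[simp] theorem afeR_of_ne_one {ψ : ClassGroup (𝓞 K) →* ℂˣ} (hψ : ψ ≠ 1) (q : ℕ) (s : ℂ) :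
    afeR K ψ q s = 0 := by
  simp [afeR, hψ]

end ConreyIwaniec2002

open ConreyIwaniec2002 NumberField

/-! ### The named statement: Proposition 8.1 in the range of its printed proof -/

/-- **Conrey–Iwaniec 2002, Proposition 8.1 (8.10), in the range of its printed proof** ("Let `S(T)`
be a set of points satisfying (8.1)–(8.3) … `D(T) = Σ_s |ℓ(s) − x(s)N̄(s)|²` … We have
`D(T) ≪ T(log q)^7 + Tℒ(T)(log T)^4` (8.10) … the implied constant being absolute"), with the
standing data of §7 (`q` odd, `q > 4`, `−q` the discriminant of `K`, `ψ ∈ Ĉℓ(K)`), for `1`-spaced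
`S ⊂ (T, 2T]` with **`q^66 ≤ T`, `e^{(log q)²} ≤ T` and companions `|t′(t) − t| ≤ 1`** (see the
module docstring for why this is the range of the printed argument: Proposition 5.4 on `[T/2,3T]`
feeding Proposition 6.4 at `T/2`; (7.23)/Lemma 7.4 for close `s′`). One absolute `C` outermost;
`D` is the tree's `defectD`. A restriction (hence a consequence) of the typed
`conreyIwaniec2002_proposition81`; the whole §§9–10 chain follows from it
(`ConreyIwaniec2002PrincipalEstimateClose.lean`). NAMED STATEMENT, not proved here.
[cite: ConreyIwaniec2002, Proposition 8.1 (8.10)] -/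
def conreyIwaniec2002_proposition81_large_close : Prop :=
  ∃ C : ℝ, 0 < C ∧
    ∀ (q : ℕ) [NeZero q], 4 < q → Odd q → ∀ χ : DirichletCharacter ℂ q,
      χ.IsPrimitive → χ.IsQuadratic → χ.Odd →
        ∀ (K : Type) [Field K] [NumberField K],
          Module.finrank ℚ K = 2 → NumberField.discr K = -(q : ℤ) →
            ∀ (ψ : ClassGroup (𝓞 K) →* ℂˣ) (T : ℝ) (S : Finset ℝ) (t' : ℝ → ℝ),
              (q : ℝ) ^ (66 : ℕ) ≤ T → Real.exp (Real.log q ^ (2 : ℕ)) ≤ T → IsDyadicPointSet S T →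
                (∀ t ∈ S, |t' t - t| ≤ 1) →
                defectD K ψ q S t' ≤
                  C * (T * Real.log q ^ (7 : ℕ) + T * calL χ T * Real.log T ^ (4 : ℕ))

/-- **The typed Proposition 8.1 implies its `_large_close` restriction** (fewer point sets, fewer
companion maps; `q^66 ≤ T` gives `T ≥ 2`). [cite: ConreyIwaniec2002, Proposition 8.1 (8.10)] -/
theorem conreyIwaniec2002_proposition81_large_close_of_proposition81
    (h : conreyIwaniec2002_proposition81) : conreyIwaniec2002_proposition81_large_close := by
  obtain ⟨C, hC, h⟩ := h
  refine ⟨C, hC, fun q _ hq hodd χ hprim hquad hoddχ K _ _ hK hdisc ψ T S t' hT _ hS _ => ?_⟩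
  have hq1 : (1 : ℝ) ≤ q := by exact_mod_cast (show 1 ≤ q by omega)
  have hq2 : (2 : ℝ) ≤ q := by exact_mod_cast (show 2 ≤ q by omega)
  have hT2 : (2 : ℝ) ≤ T := by
    calc (2 : ℝ) ≤ q := hq2
      _ = (q : ℝ) ^ (1 : ℕ) := (pow_one _).symm
      _ ≤ (q : ℝ) ^ (66 : ℕ) := pow_le_pow_right₀ hq1 (by norm_num)
      _ ≤ T := hT
  exact h q hq hodd χ hprim hquad hoddχ K hK hdisc ψ T S t' hT2 hS

end Literature.NumberTheory.LFunctions

end
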